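import Mathlib

/-!
# Route LeakageWritesInInk — SpectralBootstrap (item stmt-FinalStateConjecture-10227)

The support item `SpectralBootstrap` of route `LeakageWritesInInk` (card P1(a), pure real
analysis): a profile `a : ℝ → [0,1]` with rapid decay (`a λ ≤ C_K / λ ^ K` for `λ ≥ 1`, every `K`)
and the cascade inequality (`a λ ≤ C λ^N a(μ) a(λ-μ)` for some `μ ∈ [λ/16, λ/2]`, all `λ ≥ λ₁`)
decays exponentially: `a λ ≤ C' exp (-c λ)` for `λ ≥ 1`, some `c > 0`.

## Proof

Shell induction (the route docstring's hand proof, with the square root replaced by the cruder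
but sufficient choice `L ≥ Q`): put `K₀ = max (C_{N+2}, 1)`, `Q = 16 e C K₀ 32^{N+1}`,
`L = max (λ₁, 16, Q)`, `D = 16 e K₀ / L`, and prove by induction on `n : ℕ` that
`a ν ≤ D exp(-ν/L) / ν^{N+1}` for all `ν ∈ [L/16, (16+n) L/16)`.
* Base (`ν < L`): rapid decay at order `N+2` gives `a ν ≤ K₀/ν^{N+2} ≤ (16 K₀ / L)/ν^{N+1}`
  and `16 K₀ / L = D e^{-1} ≤ D exp(-ν/L)`.
* Step (`ν ≥ L ≥ λ₁`): the cascade gives `μ ∈ [ν/16, ν/2]`; both `μ` and `ν - μ` lie in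
  `[L/16, (16+n)L/16)`, the exponentials multiply to `exp(-ν/L)`, `μ(ν-μ) ≥ (ν/16)(ν/2) = ν²/32`,
  so `a ν ≤ C D² 32^{N+1} exp(-ν/L)/ν^{N+2} = (C D 32^{N+1}/ν) · D exp(-ν/L)/ν^{N+1}` and
  `C D 32^{N+1} = Q / L ≤ 1 ≤ ν`.
Finally `c = 1/L`, `C' = D + e` (for `1 ≤ λ < L/16` use `a ≤ 1 ≤ e · exp(-λ/L)`).

Design: this module does NOT import the route module
`Summits.FinalStateConjecture.FinalStateConjecture.Theses.LeakageWritesInInk`; the closing theorem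
`spectralBootstrap_proof` is stated with the body of the route decl `SpectralBootstrap` VERBATIM, so
its type is the route decl up to `δ`-unfolding and the gate-rendered route file can import this
module for the `SpectralBootstrap_holds` link without an import cycle.
-/

-- the doubled `FinalStateConjecture.FinalStateConjecture` path component trips dupNamespace
set_option linter.dupNamespace false

namespace Summit.FinalStateConjecture.FinalStateConjecture.Theorems.LeakageWritesInInk

/-- **Shell induction for the spectral bootstrap.** With the constants of the module docstring
(`K₀ > 0` the order-`N+2` decay constant, `L ≥ max(λ₁, 16, 16 e C K₀ 32^{N+1})`,
`D = 16 e K₀ / L`), for every `n : ℕ` and every `ν ∈ [L/16, (16+n)·L/16)` one has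
`a ν ≤ D · exp(-ν/L) / ν^{N+1}`. -/
theorem spectralBootstrap_shells
    (a : ℝ → ℝ) (N : ℕ) (C lam₁ K₀ L D : ℝ)
    (hC : 0 < C) (hK₀ : 0 < K₀)
    (ha : ∀ lam : ℝ, 0 ≤ a lam ∧ a lam ≤ 1)
    (hdec : ∀ lam : ℝ, 1 ≤ lam → a lam ≤ K₀ / lam ^ (N + 2))
    (hcasc : ∀ lam : ℝ, lam₁ ≤ lam → ∃ μ ∈ Set.Icc (lam / 16) (lam / 2),
      a lam ≤ C * lam ^ N * (a μ * a (lam - μ)))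
    (hL₁ : lam₁ ≤ L) (hL16 : 16 ≤ L)
    (hLQ : 16 * Real.exp 1 * C * K₀ * 32 ^ (N + 1) ≤ L)
    (hD : D = 16 * Real.exp 1 * K₀ / L) :
    ∀ n : ℕ, ∀ ν : ℝ, L / 16 ≤ ν → ν < (16 + n) * (L / 16) →
      a ν ≤ D * Real.exp (-(ν / L)) / ν ^ (N + 1) := by
  have hLpos : 0 < L := by linarith
  have hLne : L ≠ 0 := hLpos.ne'
  have he : 0 < Real.exp 1 := Real.exp_pos 1
  have hDpos : 0 < D := by rw [hD]; positivity
  have hL16pos : 0 < L / 16 := by positivity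
  intro n
  induction n with
  | zero =>
    intro ν hν1 hν2
    simp only [Nat.cast_zero, add_zero] at hν2
    have hνL : ν < L := by linarith
    have hνpos : 0 < ν := lt_of_lt_of_le hL16pos hν1
    have hνne : ν ≠ 0 := hνpos.ne'
    have hν1' : 1 ≤ ν := le_trans (by linarith) hν1
    have hexp : Real.exp (-1) ≤ Real.exp (-(ν / L)) := by
      rw [Real.exp_le_exp]
      have : ν / L ≤ 1 := by rw [div_le_one hLpos]; exact hνL.le
      linarith
    have hpow : 0 < ν ^ (N + 1) := by positivity
    rw [le_div_iff₀ hpow]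
    calc a ν * ν ^ (N + 1) ≤ K₀ / ν ^ (N + 2) * ν ^ (N + 1) :=
          mul_le_mul_of_nonneg_right (hdec ν hν1') hpow.le
      _ = K₀ / ν := by
          rw [pow_succ]
          field_simp
      _ ≤ K₀ / (L / 16) := div_le_div_of_nonneg_left hK₀.le hL16pos hν1
      _ = D * Real.exp (-1) := by
          rw [hD, Real.exp_neg]
          field_simp
      _ ≤ D * Real.exp (-(ν / L)) := mul_le_mul_of_nonneg_left hexp hDpos.le
  | succ n ih =>
    intro ν hν1 hν2
    push_cast at hν2
    by_cases hlt' : ν < (16 + n) * (L / 16)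
    · exact ih ν hν1 hlt'
    have hlt : (16 + n) * (L / 16) ≤ ν := not_lt.mp hlt'
    have hnL : 0 ≤ (n : ℝ) * L := by positivity
    have hνL : L ≤ ν := by nlinarith
    have hνpos : 0 < ν := by linarith
    have hνne : ν ≠ 0 := hνpos.ne'
    have hν1' : 1 ≤ ν := by linarith
    obtain ⟨μ, ⟨hμ1, hμ2⟩, hcas⟩ := hcasc ν (le_trans hL₁ hνL)
    have hμlo : L / 16 ≤ μ := by linarith
    have hμhi : μ < (16 + n) * (L / 16) := by nlinarith
    have hνμlo : L / 16 ≤ ν - μ := by linarith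
    have hνμhi : ν - μ < (16 + n) * (L / 16) := by nlinarith
    have haμ := ih μ hμlo hμhi
    have haνμ := ih (ν - μ) hνμlo hνμhi
    have hμpos : 0 < μ := by linarith
    have hνμpos : 0 < ν - μ := by linarith
    have hμne : μ ≠ 0 := hμpos.ne'
    have hνμne : ν - μ ≠ 0 := hνμpos.ne'
    -- the pairing window: μ (ν - μ) ≥ (ν/16) (ν/2) = ν² / 32
    have hprod : ν ^ 2 / 32 ≤ μ * (ν - μ) := by
      have h2 : ν / 2 ≤ ν - μ := by linarith
      calc ν ^ 2 / 32 = (ν / 16) * (ν / 2) := by ring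
        _ ≤ μ * (ν - μ) := mul_le_mul hμ1 h2 (by positivity) hμpos.le
    have hE : Real.exp (-(μ / L)) * Real.exp (-((ν - μ) / L)) = Real.exp (-(ν / L)) := by
      rw [← Real.exp_add]
      congr 1
      ring
    have hbμ_nn : 0 ≤ D * Real.exp (-(μ / L)) / μ ^ (N + 1) := by positivity
    have hP : a μ * a (ν - μ) ≤ D ^ 2 * Real.exp (-(ν / L)) / (ν ^ 2 / 32) ^ (N + 1) := by
      calc a μ * a (ν - μ)
          ≤ (D * Real.exp (-(μ / L)) / μ ^ (N + 1)) *
              (D * Real.exp (-((ν - μ) / L)) / (ν - μ) ^ (N + 1)) :=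
            mul_le_mul haμ haνμ (ha _).1 hbμ_nn
        _ = D ^ 2 * (Real.exp (-(μ / L)) * Real.exp (-((ν - μ) / L))) /
              (μ * (ν - μ)) ^ (N + 1) := by
            rw [mul_pow, div_mul_div_comm]
            ring
        _ = D ^ 2 * Real.exp (-(ν / L)) / (μ * (ν - μ)) ^ (N + 1) := by rw [hE]
        _ ≤ D ^ 2 * Real.exp (-(ν / L)) / (ν ^ 2 / 32) ^ (N + 1) := by
            gcongr
    have hCD : C * D * 32 ^ (N + 1) ≤ 1 := by
      rw [hD, show C * (16 * Real.exp 1 * K₀ / L) * 32 ^ (N + 1)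
          = (16 * Real.exp 1 * C * K₀ * 32 ^ (N + 1)) / L by ring]
      rwa [div_le_one hLpos]
    have hsmall : C * D * 32 ^ (N + 1) / ν ≤ 1 := by
      rw [div_le_one hνpos]
      linarith
    have hsplit : C * ν ^ N * (D ^ 2 * Real.exp (-(ν / L)) / (ν ^ 2 / 32) ^ (N + 1))
        = (C * D * 32 ^ (N + 1) / ν) * (D * Real.exp (-(ν / L)) / ν ^ (N + 1)) := by
      rw [div_pow]
      field_simp
      ring
    calc a ν ≤ C * ν ^ N * (a μ * a (ν - μ)) := hcas
      _ ≤ C * ν ^ N * (D ^ 2 * Real.exp (-(ν / L)) / (ν ^ 2 / 32) ^ (N + 1)) := by gcongr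
      _ = (C * D * 32 ^ (N + 1) / ν) * (D * Real.exp (-(ν / L)) / ν ^ (N + 1)) := hsplit
      _ ≤ 1 * (D * Real.exp (-(ν / L)) / ν ^ (N + 1)) := by gcongr
      _ = D * Real.exp (-(ν / L)) / ν ^ (N + 1) := one_mul _

/-- **The spectral bootstrap** (route `LeakageWritesInInk`, support item
stmt-FinalStateConjecture-10227): a profile `a : ℝ → [0,1]` with rapid decay
(`∀ K, ∃ C_K, ∀ λ ≥ 1, a λ ≤ C_K / λ^K`) and the cascade inequality
(`∀ λ ≥ λ₁, ∃ μ ∈ [λ/16, λ/2], a λ ≤ C λ^N a(μ) a(λ - μ)`, `C > 0`) decays exponentially: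
`∃ c > 0, ∃ C', ∀ λ ≥ 1, a λ ≤ C' exp(-c λ)`. The statement is VERBATIM the body of the route decl
`Summit.FinalStateConjecture.FinalStateConjecture.Theses.LeakageWritesInInk.SpectralBootstrap`
(item stmt-FinalStateConjecture-10227). Proof: `spectralBootstrap_shells` with
`L = max(λ₁, 16, 16 e C K₀ 32^{N+1})`, `c = 1/L`, `C' = D + e`. -/
theorem spectralBootstrap_proof :
    ∀ (a : ℝ → ℝ) (N : ℕ) (C lam₁ : ℝ), 0 < C → (∀ lam : ℝ, 0 ≤ a lam ∧ a lam ≤ 1) → (∀ K : ℕ, ∃ C' : ℝ, ∀ lam : ℝ, 1 ≤ lam → a lam ≤ C' / lam ^ K) → (∀ lam : ℝ, lam₁ ≤ lam → ∃ μ ∈ Set.Icc (lam / 16) (lam / 2), a lam ≤ C * lam ^ N * (a μ * a (lam - μ))) → ∃ c C' : ℝ, 0 < c ∧ ∀ lam : ℝ, 1 ≤ lam → a lam ≤ C' * Real.exp (-(c * lam)) := by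
  intro a N C lam₁ hC ha hdecay hcasc
  -- order-(N+2) decay constant, made positive
  obtain ⟨K₀, hK₀, hdec⟩ :
      ∃ K₀ : ℝ, 0 < K₀ ∧ ∀ lam : ℝ, 1 ≤ lam → a lam ≤ K₀ / lam ^ (N + 2) := by
    obtain ⟨C₂, hC₂⟩ := hdecay (N + 2)
    refine ⟨max C₂ 1, lt_of_lt_of_le one_pos (le_max_right _ _), fun lam hlam => ?_⟩
    have hlampos : 0 < lam := by linarith
    calc a lam ≤ C₂ / lam ^ (N + 2) := hC₂ lam hlam
      _ ≤ max C₂ 1 / lam ^ (N + 2) := by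
          gcongr
          exact le_max_left _ _
  have he : 0 < Real.exp 1 := Real.exp_pos 1
  -- the threshold frequency L
  obtain ⟨L, hL₁, hL16, hLQ⟩ :
      ∃ L : ℝ, lam₁ ≤ L ∧ 16 ≤ L ∧ 16 * Real.exp 1 * C * K₀ * 32 ^ (N + 1) ≤ L :=
    ⟨max (max lam₁ 16) (16 * Real.exp 1 * C * K₀ * 32 ^ (N + 1)),
      le_trans (le_max_left _ _) (le_max_left _ _),
      le_trans (le_max_right _ _) (le_max_left _ _), le_max_right _ _⟩
  have hLpos : 0 < L := by linarith
  have hL16pos : 0 < L / 16 := by positivity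
  have hshell := spectralBootstrap_shells a N C lam₁ K₀ L (16 * Real.exp 1 * K₀ / L)
    hC hK₀ ha hdec hcasc hL₁ hL16 hLQ rfl
  have hDpos : 0 < 16 * Real.exp 1 * K₀ / L := by positivity
  refine ⟨1 / L, 16 * Real.exp 1 * K₀ / L + Real.exp 1, by positivity, ?_⟩
  intro lam hlam
  have hlampos : 0 < lam := by linarith
  -- every λ lies in some shell
  obtain ⟨n, hn⟩ := exists_nat_gt (lam / (L / 16))
  rw [div_lt_iff₀ hL16pos] at hn
  have hnL : 0 ≤ (n : ℝ) * L := by positivity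
  have hlt : lam < (16 + n) * (L / 16) := by nlinarith
  have hexp_eq : Real.exp (-(1 / L * lam)) = Real.exp (-(lam / L)) := by
    congr 1
    ring
  rw [hexp_eq]
  by_cases hcase : L / 16 ≤ lam
  · have hb := hshell n lam hcase hlt
    have hpow1 : 1 ≤ lam ^ (N + 1) := one_le_pow₀ hlam
    calc a lam ≤ 16 * Real.exp 1 * K₀ / L * Real.exp (-(lam / L)) / lam ^ (N + 1) := hb
      _ ≤ 16 * Real.exp 1 * K₀ / L * Real.exp (-(lam / L)) := div_le_self (by positivity) hpow1
      _ ≤ (16 * Real.exp 1 * K₀ / L + Real.exp 1) * Real.exp (-(lam / L)) := by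
          gcongr
          linarith
  · have hcase : lam < L / 16 := not_le.mp hcase
    have hexp : Real.exp (-1) ≤ Real.exp (-(lam / L)) := by
      rw [Real.exp_le_exp]
      have : lam / L ≤ 1 := by
        rw [div_le_one hLpos]
        linarith
      linarith
    calc a lam ≤ 1 := (ha lam).2
      _ = Real.exp 1 * Real.exp (-1) := by
          rw [← Real.exp_add]
          norm_num
      _ ≤ Real.exp 1 * Real.exp (-(lam / L)) := by gcongr
      _ ≤ (16 * Real.exp 1 * K₀ / L + Real.exp 1) * Real.exp (-(lam / L)) := by
          gcongr
          linarith

end Summit.FinalStateConjecture.FinalStateConjecture.Theorems.LeakageWritesInInk
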